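import Mathlib
import Literature.MathematicalPhysics.QuantumFieldTheory.Balaban1983to89.B12Average012Prop1
import Literature.MathematicalPhysics.QuantumFieldTheory.Balaban1983to89.B7Prop2Explicit

/-!
# `Balaban1983to89.B12Average012Prop2` — [Balaban1987RG1] p. 254 «all results of the paper [12] are valid for
# it»: [12] = [B7]'s PROPOSITION 2 (52)–(54) «|Ū^k(∂p) − 1| < α₀ + 2C₀α₀² < 2α₀» PROVED for the `k`-fold average
# (0.12) built from the AVERAGED CONTOUR VARIABLES (0.11), for unitary configurations in any C⋆-algebra
# (`G = U(N)` included), uniformly in `k`; with it the two in-text uses in [I], p. 260 and p. 265 «By Proposition 2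
# from the paper [12] this implies that |W(∂p′) − 1| < 2ε₀», for the ACTUAL average of [I]; and, as the closure
# property that makes the averaging iterable, (0.9) «if 𝐔_j ∈ G, then M({𝐔_j}) ∈ G also» for the tree's solution
# of (0.10) and `G` = the unitary group of a C⋆-algebra

HONEST FRAMING (cell `lit-balaban`, verbatim): statement-level skeleton of published theorems with citation tags;
proofs where landed; nothing here is a claim about the Yang–Mills mass gap.

CITATION HEADER.  T. Bałaban, *Renormalization group approach to lattice gauge field theories. I. Generation of
effective actions in a small field approximation and a coupling constant renormalization in four dimensions*,
Commun. Math. Phys. **109** (1987) 249–301, doi:10.1007/bf01215223 [Balaban1987RG1] (cell paper B12 = «[I]»).  PDF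
held: `paper:balaban1987-cmp109-rg-i-small-field` (journal page = PDF page + 248); pp. 253–254 [PDF 5–6] and p. 265
[PDF 17] re-read this generation from the held text (`lit read … --pages 6`, `… p0017.txt` lines 10–14).  [12] = [B7]
= [Balaban1985Averaging] T. Bałaban, *Averaging operations for lattice gauge theories*, Commun. Math. Phys. **98**
(1985) 17–51, Proposition 2 (52)–(54) p. 26 — its printed statement is quoted from the tree leaf `B7.Prop2Printed`
(module `B7`, which READ p. 26), its arithmetic (53) ⇒ (54) is the tree's `B7.ineq53_induction` / `B7.prop2_of_ineq53`
/ `B7.geom_bracket_le_two` / `B7.prop2_ratio_lt_half` / `B7.prop2_bound_lt_two_alpha`, and its tree PROOF for the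
average (42)/(43) is `B7Prop2Explicit` (b07 lineage; for the p. 260 / p. 265 sentences over that MODEL average:
`B12Prop2Claims260`, seat p29) — nothing of [B7] is re-quoted from memory here.  Unit `lit-balaban-r09` gen 9 (display
owner of CMP 109; TAKING line `HOME/STATUS.md` 2026-08-21T08:3xZ), HOME `run/shared/lean/pub/lit-balaban/`; SKELETON
rows `B12.Eq0.12` (the average; «all results of the paper [12] are valid for it»), `B12.Eq2.1` (the parenthetical
«⇒ |W(∂p′) − 1| < 2ε₀, Prop 2 [12]»), `B12.Eq1.2` («⇒» direction), `B12.Eq0.9` ((0.9)), `B7.Prop2` (consumer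
instance only; the [B7] row's head is r04's).

WHAT IS PRINTED (verbatim).  [I] p. 253: *«An average should have the following properties … if 𝐔_j ∈ G, then
M({𝐔_j}) ∈ G also. (0.9)»*  p. 254: *«This average has properties similar to the properties of the average
introduced in (0.4), especially all results of the paper [12] are valid for it. The proofs are in most cases
unchanged; in others only minor and obvious modifications are needed.»*  p. 260: *«By Proposition 2 [12] this
condition implies that |V(∂p′) − 1| < 2ε₀ for p′ ∈ T_1^{(k)}»* (the condition: (1.2) `|U(∂p) − 1| < ε₀η²`,
`η = L^{−k}`, `p ∈ T`; `V = M^k(U)` by (1.1)).  p. 265: *«More exactly we assume that W is so regular that the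
minimal configurations U_{k+1}(W) exist and belong to the space U_{k+1}(ε₀). By Proposition 2 from the paper [12]
this implies that |W(∂p′) − 1| < 2ε₀ for p′ ∈ T^{(k+1)}.»*  [B7] Proposition 2, p. 26 (quoted from the tree leaf
`B7.Prop2Printed`): *«If U satisfies (52) with α₀ ≤ c₂ = min{1/(3C₀), ½c′₂}, then |Ū^k(∂p) − 1| < α₀ + 2C₀α₀² <
2α₀, p ⊂ Ω^{(k)} (54).»*, (52) being `|U(∂p) − 1| < α₀η²`, `η = L^{−k}`, and (43) p. 24 `Ū^{k+1}_c =
\overline{(Ū^k)}_c`.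

DICTIONARY print → Lean (objects PRE-EXISTING in the b12/b07 lineages unless marked NEW).  As in
`B12Average012Prop1` (fine lattice `ℤᵈ`, bonds `ZdEdge d`, corner cubes, plaquette variables `plaquetteHolonomyZd`,
`Ū = B12SmallFieldRegion255.avgBar L U`, coarse bonds indexed by coarse coordinates); `G`-valued, `G ⊂ U(N)` ↦
values in `B7Prop2Explicit.unitaryUnits 𝔸`, the unitary group of a C⋆-algebra `𝔸` (`M_N(ℂ)` with the operator
norm and `G = U(N)` in § 6); [B7] (43) `Ū^{k+1} = \overline{(Ū^k)}` ↦ NEW `avgIter012 L U (j+1) = avgBar L (avgIter012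
L U j)` — NO rescaling map is needed, the lineage's `avgBar` is already indexed by the coarse lattice `ℤᵈ` (compare
`B7Prop2Explicit.avgIter = rescale ∘ bavg`); `sup_p |U(∂p) − 1|` ↦ NEW `pdevZ U` (a real supremum over all
plaquettes `(x; i, j)` of `ℤᵈ`, the `ZdEdge` twin of `B7Prop2Explicit.pdev`); (52) ↦ `pdevZ U < α₀·(L^k)⁻²`; the
constants: NEW `C0A d = 500·(8(d+1)(d+4))²` (the `C₀` of `B12Average012Prop1.prop1_avgBar`) and the tree's
`B7Prop2Explicit.c2' d L = 1/(512(d+1)(d+4)L²)`; Federbush's mean (0.10) ↦ the tree's `FederbushMean.fedSol`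
(`B12ContourAverage253.fedUnit/fedAvg/Tavg`); [B7]'s abstract `k`-fold carrier / printed leaf ↦ `B7.KStep` /
`B7.Prop2Printed`, instantiated by NEW `concreteKStep012`.

THE ARGUMENT FORMALISED (print: [B7] p. 26 «by induction» from Prop. 1; the closure of the group under the
average is tacit).  (i) (0.9) IN A C⋆-ALGEBRA (§ 1, `fedSol_mem_unitary`): for a unitary family `W_j` with
`‖W_j − 1‖ ≤ 1/100`, `Y = (X⁻¹)⋆`, `X = fedSol W`, solves (0.10) in the uniqueness ball — `log(W_j(X⁻¹)⋆) =
(log(X⁻¹W_j⋆))⋆ = −(log(W_jX))⋆` (`ExpMeanLog.mlog_eq_neg_of_mul_eq_one`, `log X⋆ = (log X)⋆` from `B7BlockAvgLog.mlog_exp`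
and `NormedSpace.star_exp`) — so `Y = X` (`FederbushMean.fedSol_unique`), i.e. `X⋆ = X⁻¹`; this is the matrix proof
`FederbushMean.fedSol_mem_unitaryGroup` of the tree, rewritten for an abstract C⋆-algebra.  (ii) CLOSURE (§ 2): on an
`ε₀`-regular unitary configuration with `(dL)²ε₀ ≤ 1/100`, `𝐔(q,x) = X(x)⁻¹U(Γ_{q,x})` is unitary (the relative
family `{U(Γ^π)U(Γ)⁻¹}` is unitary and `(dL)²ε₀`-small, `B12ContourAverage253.rel_permT_small`), so are the (0.12)
loops, within `ω_A = 10(dL)²ε₀ ≤ 1/10` of `1` (`B12ContourAverage253.norm_loopW_Tavg_sub_one_le_local`), whose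
logarithms are therefore skew-adjoint (`B7Prop2Explicit.star_mlog_eq_neg`, [B7] (22)–(23)); the exponent of (0.12)
is skew-adjoint, its exponential unitary (Mathlib `NormedSpace.exp_mem_unitary_of_mem_skewAdjoint`), and `Ū(c) =
e^{A(c)}U(c)` is unitary (`avgBar_mem_unitaryUnits`).  (iii) ONE STEP (§ 3, `step012_lt`): [B7] Prop. 1 for the
(0.12)/(0.11) average (`B12Average012Prop1.prop1_avgBar`) at every coarse plaquette, then the supremum:
`pdevZ W < P ≤ c₂′ ⇒ pdevZ W̄ < L²P + C₀(L²P)²`.  (iv) (53)–(54) (§ 4): the tree's arithmetic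
`B7.ineq53_induction` / `B7.prop2_of_ineq53` with `step` discharged by (iii) at every level, the unitarity of all
levels `j ≤ k` carried along by induction (`avgIter012_mem`: (53) at level `j` gives `pdevZ Ū^j < 2α₀ ≤ c₂′`, so
`(dL)²·pdevZ Ū^j ≤ 1/512` and (ii) applies) — verbatim the structure of `B7Prop2Explicit.avgIter_mem` /
`prop2_explicit`.  (v) § 5–§ 7: the printed leaf `B7.Prop2Printed` (`c₂ = min{1/(3C₀), ½c₂′}` exactly as printed),
`G = U(N) ⊂ M_N(ℂ)`, and the p. 260 / p. 265 sentences with ONE displayed threshold `L²ε₀ ≤ 1/(3C₀)`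
(`smallness012_of_L2`).

WHAT IS PROVED (kernel-checked, no `sorry`, axioms `propext`, `Classical.choice`, `Quot.sound`; definitions with
bodies: `pdevZ`, `C0A`, `avgIter012`, `concreteKStep012`; everything else theorems; NO `Prop` placeholder, net new
unproved facts 0).  `fedSol_mem_unitary` ((0.9), any C⋆-algebra); `permT_mem_unitaryUnits`, `lineR_mem_unitaryUnits`,
`Tavg_mem_unitaryUnits`, `loopW_Tavg_mem_unitaryUnits`, **`avgBar_mem_unitaryUnits`**; `pdevZ_nonneg`, `pdevZ_bddAbove`,
`le_pdevZ`, `C0A_pos`, **`step012_lt`**; `avgIter012_zero/succ`, **`avgIter012_mem`**, **`ineq53_012`**, **`prop2_012`**,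
**`prop2_012_lt_two`**; **`prop2Printed_avgBar`**, `prop2Printed_avgBar_unitaryGroup`; `smallness012_of_L2`,
**`claim260_012`**, **`claim265_012`**.

DIVERGENCES FROM PRINT / WHAT IS NOT PROVED (honest scope).  (a) As `B12Average012Prop1` (a): `ℤᵈ` corner cubes and
the lineage's realisation of (0.10)–(0.12); unitary (`G ⊂ U(N)`-type) configurations in a C⋆-algebra, NOT print's
`Gᶜ`-valued ones; regularity as the strict bound on the supremum over ALL plaquettes of `ℤᵈ` ((52) «on some set of
plaquettes»; [B7]'s locality remark p. 26 is NOT transported — for the model average it is `B7Prop1Local`).  (b) (0.9)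
is proved for `G` = the full unitary group of a C⋆-algebra (so `U(N)`); for a proper closed subgroup `G ⊂ U(N)`
(e.g. `SU(N)`) the tree has (0.9) for (0.10) via `BlockAveragingFederbushGValued.fedSol_mem_logChart` and the
`SU(N)` radius files, and [B7] Prop. 2 for the model average via `B7Prop2SpecialUnitary`; the corresponding closure of
the (0.12)/(0.11) average in `SU(N)` is NOT done here.  (c) CONSTANTS: `C₀ = 500·64(d+1)²(d+4)²` (from
`B12Average012Prop1`), `c₂′ = 1/(512(d+1)(d+4)L²)`, `c₂ = min{1/(3C₀), ½c₂′}`; `L ≥ 2`, `d ≥ 1`.  (d) Of «all results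
of the paper [12]» this file transports ONLY Proposition 2 (after (11) `B12Average012Covariance` and Prop. 1
`B12Average012Prop1`); Propositions 3–10 and the analyticity statements for the (0.11)/(0.12) average are NOT
touched.  (e) The identifications `V = M^k(U_k(V))` ((1.1)) and `W = M^{k+1}(U_{k+1}(W))` are the DICTIONARY, as in
`B12Prop2Claims260` (M2): the theorems conclude on `Ū^k(U)` for an arbitrary unitary `U` and apply verbatim to the
minimizers; the `J`-condition of (1.2) plays no role (Prop. 2 sees plaquettes only).
-/

noncomputable section

open NormedSpace Finset

namespace Literature.MathematicalPhysics.QuantumFieldTheory.Balaban1983to89.B12Average012Prop2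

open Literature.MathematicalPhysics.QuantumLattice (ZdEdge blockMap blockBase blockSites mem_blockSites_iff
  card_blockSites plaquetteHolonomyZd)
open B7Eq61Linearization (lineR)
open B7Prop1Explicit (hol U1 mem_U1)
open B7Prop2Explicit (unitaryUnits mem_unitaryUnits unitaryUnits_le_U1 star_mlog_eq_neg hol_mem_of c2' c2'_pos)
open B12HOperator267 (gammaT)
open B12AverageCorridor267 (Ustr loopW loopW_def avgM expU val_expU add_mem_blockSites_succ)
open B12PlaquetteLoop267 (hol_seg_eq_lineR)
open B12ContourAverage253 (rel permT permT_one fedUnit val_fedUnit Tavg Tavg_eq rel_permT_small omegaA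
  norm_loopW_Tavg_sub_one_le_local)
open B12SmallFieldRegion255 (avgBar)
open B12Average012Prop1 (prop1_avgBar)
open FederbushMean (fedSol fedSol_spec fedSol_unique sum_mlog_mul_fedSol fed_def norm_mul_sub_one_le
  isUnit_and_norm_inverse_sub_one_le)
open MatrixLog (mlog mlog_one norm_mlog_le_two_mul exp_mlog)
open B7BlockAvgLog (mlog_exp)

variable {d : ℕ}

/-! ## § 1  (0.9) for Federbush's solution of (0.10) in a C⋆-algebra: the mean of a unitary family is unitary -/

section UnitaryMean

variable {𝔸 : Type*} [CStarAlgebra 𝔸]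

/-- [folklore] `‖X⋆ − 1‖ = ‖X − 1‖` in a C⋆-algebra. -/
private theorem norm_star_sub_one (X : 𝔸) : ‖star X - 1‖ = ‖X - 1‖ := by
  calc ‖star X - 1‖ = ‖star (X - 1)‖ := by rw [star_sub, star_one]
    _ = ‖X - 1‖ := norm_star _

/-- [folklore] `log X⋆ = (log X)⋆` for `‖X − 1‖ ≤ 1/3` (series logarithm; `X⋆ = (e^{log X})⋆ = e^{(log X)⋆}`,
`‖(log X)⋆‖ < ln 2`, `log ∘ exp = id` there). -/
private theorem mlog_star {X : 𝔸} (hX : ‖X - 1‖ ≤ 1 / 3) : mlog (star X) = star (mlog X) := by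
  letI : NormedAlgebra ℚ 𝔸 := NormedAlgebra.restrictScalars ℚ ℂ 𝔸
  have hX1 : ‖X - 1‖ < 1 := lt_of_le_of_lt hX (by norm_num)
  have h2 : star X = exp (star (mlog X)) := by rw [← star_exp, exp_mlog hX1]
  rw [h2]
  exact mlog_exp (by rw [norm_star]; exact ExpMeanLog.norm_mlog_lt_log_two hX)

variable {ι : Type*} [Fintype ι] [Nonempty ι]

/-- [cite: Balaban1987RG1, (0.9) p.253] **(0.9) «if 𝐔_j ∈ G, then M({𝐔_j}) ∈ G also» FOR `G` = THE UNITARY GROUP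
OF A C⋆-ALGEBRA**, for the tree's solution of (0.10): if every `W_j` is unitary with `‖W_j − 1‖ ≤ 1/100`, then
`fedSol W` is unitary.  (`Y = (X⁻¹)⋆` also solves (0.10) in the uniqueness ball — `log(W_j (X⁻¹)⋆) =
(log(X⁻¹W_j⋆))⋆ = −(log(W_jX))⋆` — so `Y = X`; the matrix case is `FederbushMean.fedSol_mem_unitaryGroup`.) -/
theorem fedSol_mem_unitary {W : ι → 𝔸} (hWu : ∀ j, W j ∈ unitary 𝔸) (hW : ∀ j, ‖W j - 1‖ ≤ 1 / 100) :
    fedSol W ∈ unitary 𝔸 := by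
  have hX : ‖fedSol W - 1‖ ≤ 3 / 100 := (fedSol_spec hW).1
  obtain ⟨hu, hinv⟩ := isUnit_and_norm_inverse_sub_one_le hX (by norm_num)
  have hXXi : fedSol W * Ring.inverse (fedSol W) = 1 := Ring.mul_inverse_cancel _ hu
  have hXiX : Ring.inverse (fedSol W) * fedSol W = 1 := Ring.inverse_mul_cancel _ hu
  have hXi1 : ‖Ring.inverse (fedSol W) - 1‖ ≤ 1 / 25 := hinv.trans (by norm_num)
  have hY1 : ‖star (Ring.inverse (fedSol W)) - 1‖ ≤ 2 / 25 := by rw [norm_star_sub_one]; linarith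
  have hterm : ∀ j, mlog (W j * star (Ring.inverse (fedSol W))) = -star (mlog (W j * fedSol W)) := by
    intro j
    have hWX : ‖W j * fedSol W - 1‖ ≤ 1 / 3 := (norm_mul_sub_one_le (hW j) hX).trans (by norm_num)
    have hprod : W j * fedSol W * (Ring.inverse (fedSol W) * star (W j)) = 1 := by
      calc W j * fedSol W * (Ring.inverse (fedSol W) * star (W j))
          = W j * (fedSol W * Ring.inverse (fedSol W)) * star (W j) := by noncomm_ring
        _ = 1 := by rw [hXXi, mul_one]; exact Unitary.mul_star_self_of_mem (hWu j)
    have h1 : mlog (Ring.inverse (fedSol W) * star (W j)) = -mlog (W j * fedSol W) :=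
      ExpMeanLog.mlog_eq_neg_of_mul_eq_one hprod hWX
    have hWj : ‖star (W j) - 1‖ ≤ 1 / 100 := by rw [norm_star_sub_one]; exact hW j
    have hsmall : ‖Ring.inverse (fedSol W) * star (W j) - 1‖ ≤ 1 / 3 :=
      (norm_mul_sub_one_le hXi1 hWj).trans (by norm_num)
    calc mlog (W j * star (Ring.inverse (fedSol W)))
        = mlog (star (Ring.inverse (fedSol W) * star (W j))) := by rw [star_mul, star_star]
      _ = star (mlog (Ring.inverse (fedSol W) * star (W j))) := mlog_star hsmall
      _ = -star (mlog (W j * fedSol W)) := by rw [h1, star_neg]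
  have hfY : FederbushMean.fed W (star (Ring.inverse (fedSol W))) = 0 := by
    have h0 := sum_mlog_mul_fedSol hW
    rw [fed_def]
    simp only [hterm, Finset.sum_neg_distrib, ← star_sum, h0, star_zero, neg_zero, smul_zero]
  have hYeq : star (Ring.inverse (fedSol W)) = fedSol W := fedSol_unique hW hY1 hfY
  have hstarX : star (fedSol W) = Ring.inverse (fedSol W) := by
    have h := congrArg star hYeq
    rw [star_star] at h
    exact h.symm
  rw [Unitary.mem_iff, hstarX]
  exact ⟨hXiX, hXXi⟩

end UnitaryMean

/-! ## § 2  The averaged contour variables (0.11) and the average (0.12) of a unitary configuration are unitary -/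

section UnitaryAverage

variable {𝔸 : Type*} [CStarAlgebra 𝔸] [Nontrivial 𝔸] {L : ℕ}

omit [Nontrivial 𝔸] in
/-- [folklore] the complex weight `L⁻ᵈ` acts as the real weight `L⁻ᵈ`. -/
private theorem weight_smul_eq (a : 𝔸) : ((L : ℂ) ^ d)⁻¹ • a = ((L : ℝ) ^ d)⁻¹ • a := by
  rw [show ((L : ℂ) ^ d)⁻¹ = ((((L : ℝ) ^ d)⁻¹ : ℝ) : ℂ) by push_cast; rfl, Complex.coe_smul]

omit [Nontrivial 𝔸] in
/-- [cite: Balaban1987RG1, p.252] every contour transporter `U(Γ^π_{q,x})` of a unitary configuration is unitary. -/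
theorem permT_mem_unitaryUnits (U : ZdEdge d → 𝔸ˣ) (hU : ∀ b, U b ∈ unitaryUnits 𝔸)
    (π : Equiv.Perm (Fin d)) (x : Fin d → ℤ) : permT L U π x ∈ unitaryUnits 𝔸 := by
  unfold permT
  exact hol_mem_of (fun z κ => hU (z, κ)) _ _

omit [Nontrivial 𝔸] in
/-- [cite: Balaban1987RG1, (0.12) p.254] straight transporters `U([x, x + n e_μ])` of a unitary configuration are
unitary. -/
theorem lineR_mem_unitaryUnits (U : ZdEdge d → 𝔸ˣ) (hU : ∀ b, U b ∈ unitaryUnits 𝔸) (x : Fin d → ℤ)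
    (μ : Fin d) (n : ℕ) : lineR U x μ n ∈ unitaryUnits 𝔸 := by
  rw [← hol_seg_eq_lineR]
  exact hol_mem_of (fun z κ => hU (z, κ)) _ _

/-- [cite: Balaban1987RG1, (0.9) p.253] **THE AVERAGED CONTOUR VARIABLE `𝐔(q,x)` OF A UNITARY CONFIGURATION IS
UNITARY** — (0.9) for the family `{U(Γ)}_{Γ∈𝐆(q,x)}` — on an `ε₀`-regular configuration with `(dL)²ε₀ ≤ 1/100`
(the relative family is `(dL)²ε₀`-small, `B12ContourAverage253.rel_permT_small`; § 1). -/
theorem Tavg_mem_unitaryUnits (hL : 0 < L) (U : ZdEdge d → 𝔸ˣ) (hU : ∀ b, U b ∈ unitaryUnits 𝔸) {ε₀ : ℝ}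
    (hε₀ : 0 ≤ ε₀) (hsm : ((d : ℝ) * L) ^ 2 * ε₀ ≤ 1 / 100)
    (h44 : ∀ (p : Fin d → ℤ) (i j : Fin d), i ≠ j → ‖((plaquetteHolonomyZd U p i j : 𝔸ˣ) : 𝔸) - 1‖ ≤ ε₀)
    (x : Fin d → ℤ) : Tavg L U x ∈ unitaryUnits 𝔸 := by
  haveI : NeZero L := ⟨hL.ne'⟩
  have hU1 : ∀ b, U b ∈ U1 𝔸 := fun b => unitaryUnits_le_U1 (hU b)
  have hx : x ∈ blockSites L (blockMap L x) := (mem_blockSites_iff L _ x).2 rfl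
  have hF : ∀ π, permT L U π x ∈ unitaryUnits 𝔸 := fun π => permT_mem_unitaryUnits U hU π x
  have hrelU : ∀ π, rel (fun π : Equiv.Perm (Fin d) => permT L U π x) 1 π ∈ unitary 𝔸 := fun π => by
    have h := (unitaryUnits 𝔸).mul_mem (hF π) ((unitaryUnits 𝔸).inv_mem (hF 1))
    rw [mem_unitaryUnits, Units.val_mul] at h
    exact h
  have hrel : ∀ π, ‖rel (fun π : Equiv.Perm (Fin d) => permT L U π x) 1 π - 1‖ ≤ 1 / 100 := fun π =>
    (rel_permT_small hL U (fun b => (mem_U1.mp (hU1 b)).1) (fun b => (mem_U1.mp (hU1 b)).2) hε₀ hx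
      (fun p i j hij _ _ => h44 p i j hij) π).trans hsm
  have hsol : fedSol (rel (fun π : Equiv.Perm (Fin d) => permT L U π x) 1) ∈ unitary 𝔸 :=
    fedSol_mem_unitary hrelU hrel
  have hunit : fedUnit (rel (fun π : Equiv.Perm (Fin d) => permT L U π x) 1) ∈ unitaryUnits 𝔸 := by
    rw [mem_unitaryUnits, val_fedUnit]
    exact hsol
  rw [Tavg_eq hL, ← permT_one hL]
  exact (unitaryUnits 𝔸).mul_mem ((unitaryUnits 𝔸).inv_mem hunit) (hF 1)

/-- [cite: Balaban1987RG1, (0.12) p.254] the (0.12) loops `W^avg_x` of a unitary configuration are unitary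
(products of the unitary `𝐔(c₋,x)`, `U([x,x′])`, `𝐔(c₊,x′)⁻¹`, `U(c)⁻¹`). -/
theorem loopW_Tavg_mem_unitaryUnits (hL : 0 < L) (U : ZdEdge d → 𝔸ˣ) (hU : ∀ b, U b ∈ unitaryUnits 𝔸)
    {ε₀ : ℝ} (hε₀ : 0 ≤ ε₀) (hsm : ((d : ℝ) * L) ^ 2 * ε₀ ≤ 1 / 100)
    (h44 : ∀ (p : Fin d → ℤ) (i j : Fin d), i ≠ j → ‖((plaquetteHolonomyZd U p i j : 𝔸ˣ) : 𝔸) - 1‖ ≤ ε₀)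
    (c : ZdEdge d) (x : Fin d → ℤ) :
    loopW L (fun U : ZdEdge d → 𝔸ˣ => Tavg L U) U c x ∈ unitaryUnits 𝔸 := by
  rw [loopW_def]
  have hT := fun z => Tavg_mem_unitaryUnits hL U hU hε₀ hsm h44 z
  refine (unitaryUnits 𝔸).mul_mem ((unitaryUnits 𝔸).mul_mem ((unitaryUnits 𝔸).mul_mem (hT x)
    (lineR_mem_unitaryUnits U hU x c.2 L)) ((unitaryUnits 𝔸).inv_mem (hT _))) ((unitaryUnits 𝔸).inv_mem ?_)
  exact lineR_mem_unitaryUnits U hU _ c.2 L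

/-- [cite: Balaban1987RG1, (0.12) p.254] **THE AVERAGE (0.12) OVER THE AVERAGED CONTOUR VARIABLES (0.11) OF A
UNITARY CONFIGURATION IS UNITARY** (what makes the averaging iterable, [B7] (43); tacit in print, where the
configurations are `G`-valued and the averages `Gᶜ`-valued «in general», p. 253): on an `ε₀`-regular unitary
configuration with `(dL)²ε₀ ≤ 1/100` the exponent of (0.12) is skew-adjoint (every loop is unitary and within
`ω_A = 10(dL)²ε₀ ≤ 1/10` of `1`, so its logarithm is skew-adjoint, `B7Prop2Explicit.star_mlog_eq_neg`), its
exponential is unitary (Mathlib `NormedSpace.exp_mem_unitary_of_mem_skewAdjoint`), and `Ū(c) = e^{A(c)}U(c)` is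
unitary. -/
theorem avgBar_mem_unitaryUnits (hL : 0 < L) (hd : 1 ≤ d) (U : ZdEdge d → 𝔸ˣ) (hU : ∀ b, U b ∈ unitaryUnits 𝔸)
    {ε₀ : ℝ} (hε₀ : 0 ≤ ε₀) (hsm : ((d : ℝ) * L) ^ 2 * ε₀ ≤ 1 / 100)
    (h44 : ∀ (p : Fin d → ℤ) (i j : Fin d), i ≠ j → ‖((plaquetteHolonomyZd U p i j : 𝔸ˣ) : 𝔸) - 1‖ ≤ ε₀)
    (c : ZdEdge d) : avgBar L U c ∈ unitaryUnits 𝔸 := by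
  have hU1 : ∀ b, U b ∈ U1 𝔸 := fun b => unitaryUnits_le_U1 (hU b)
  have hloop : ∀ x ∈ blockSites L c.1,
      ‖((loopW L (fun U : ZdEdge d → 𝔸ˣ => Tavg L U) U c x : 𝔸ˣ) : 𝔸) - 1‖ ≤ 1 / 4 := by
    intro x hx
    have h := norm_loopW_Tavg_sub_one_le_local hL hd U (fun b => (mem_U1.mp (hU1 b)).1)
      (fun b => (mem_U1.mp (hU1 b)).2) hε₀ hsm c (fun p i j hij _ _ => h44 p i j hij) hx
    have hω : omegaA d L ε₀ ≤ 1 / 4 := by rw [omegaA]; linarith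
    exact h.trans hω
  have hA : (∑ x ∈ blockSites L c.1, ((L : ℂ) ^ d)⁻¹ •
      mlog ((loopW L (fun U : ZdEdge d → 𝔸ˣ => Tavg L U) U c x : 𝔸ˣ) : 𝔸)) ∈ skewAdjoint 𝔸 := by
    refine sum_mem fun x hx => ?_
    rw [weight_smul_eq]
    refine skewAdjoint.smul_mem _ ?_
    rw [skewAdjoint.mem_iff]
    exact star_mlog_eq_neg (loopW_Tavg_mem_unitaryUnits hL U hU hε₀ hsm h44 c x) (hloop x hx)
  letI : NormedAlgebra ℚ 𝔸 := NormedAlgebra.restrictScalars ℚ ℂ 𝔸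
  have hexp := NormedSpace.exp_mem_unitary_of_mem_skewAdjoint hA
  have hS : Ustr L U c ∈ unitaryUnits 𝔸 := lineR_mem_unitaryUnits U hU _ c.2 L
  rw [mem_unitaryUnits] at hS ⊢
  show exp (∑ x ∈ blockSites L c.1, ((L : ℂ) ^ d)⁻¹ •
      mlog ((loopW L (fun U : ZdEdge d → 𝔸ˣ => Tavg L U) U c x : 𝔸ˣ) : 𝔸)) * ((Ustr L U c : 𝔸ˣ) : 𝔸) ∈ unitary 𝔸
  exact Submonoid.mul_mem _ hexp hS

end UnitaryAverage

/-! ## § 3  The plaquette deviation and the one-step estimate: [B7] Proposition 1 for `avgBar`, all plaquettes -/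

section Step

variable {𝔸 : Type*} [NormedRing 𝔸] [NormedAlgebra ℂ 𝔸] [NormOneClass 𝔸] [CompleteSpace 𝔸] {L : ℕ}

/-- [cite: Balaban1985Averaging, (52) p.26] `sup_p ‖U(∂p) − 1‖` over all unit plaquettes `p = (x; i, j)` of `ℤᵈ`
(the quantity of (44), (52)–(54); `B7Prop2Explicit.pdev` for the `ZdEdge` indexing of the b12 lineage). -/
def pdevZ (U : ZdEdge d → 𝔸ˣ) : ℝ :=
  ⨆ p : (Fin d → ℤ) × Fin d × Fin d, ‖((plaquetteHolonomyZd U p.1 p.2.1 p.2.2 : 𝔸ˣ) : 𝔸) - 1‖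

omit [NormedAlgebra ℂ 𝔸] [NormOneClass 𝔸] [CompleteSpace 𝔸] in
/-- [cite: Balaban1985Averaging, (52) p.26] the deviation `sup_p ‖U(∂p) − 1‖` is `≥ 0`. -/
theorem pdevZ_nonneg (U : ZdEdge d → 𝔸ˣ) : 0 ≤ pdevZ U := Real.iSup_nonneg fun _ => norm_nonneg _

omit [NormedAlgebra ℂ 𝔸] [CompleteSpace 𝔸] in
/-- [folklore] plaquette variables of a `U1`-valued configuration lie in `U1`. -/
private theorem plaq_mem_U1 {U : ZdEdge d → 𝔸ˣ} (hU : ∀ b, U b ∈ U1 𝔸) (p : Fin d → ℤ) (i j : Fin d) :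
    plaquetteHolonomyZd U p i j ∈ U1 𝔸 := by
  unfold plaquetteHolonomyZd
  exact (U1 𝔸).mul_mem ((U1 𝔸).mul_mem ((U1 𝔸).mul_mem (hU _) (hU _)) ((U1 𝔸).inv_mem (hU _)))
    ((U1 𝔸).inv_mem (hU _))

omit [NormedAlgebra ℂ 𝔸] [CompleteSpace 𝔸] in
/-- [cite: Balaban1985Averaging, (52) p.26] for a `U1`-valued configuration every `‖U(∂p) − 1‖ ≤ 2`, so the deviation
`sup_p ‖U(∂p) − 1‖` of (44)/(52) is a genuine supremum. -/
theorem pdevZ_bddAbove {U : ZdEdge d → 𝔸ˣ} (hU : ∀ b, U b ∈ U1 𝔸) :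
    BddAbove (Set.range fun p : (Fin d → ℤ) × Fin d × Fin d =>
      ‖((plaquetteHolonomyZd U p.1 p.2.1 p.2.2 : 𝔸ˣ) : 𝔸) - 1‖) := by
  refine ⟨2, ?_⟩
  rintro _ ⟨p, rfl⟩
  refine (norm_sub_le _ _).trans ?_
  rw [norm_one]
  have := (plaq_mem_U1 hU p.1 p.2.1 p.2.2).1
  linarith

omit [NormedAlgebra ℂ 𝔸] [CompleteSpace 𝔸] in
/-- [cite: Balaban1985Averaging, (52) p.26] `‖U(∂p) − 1‖ ≤ sup_p ‖U(∂p) − 1‖` for every unit plaquette. -/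
theorem le_pdevZ {U : ZdEdge d → 𝔸ˣ} (hU : ∀ b, U b ∈ U1 𝔸) (x : Fin d → ℤ) (i j : Fin d) :
    ‖((plaquetteHolonomyZd U x i j : 𝔸ˣ) : 𝔸) - 1‖ ≤ pdevZ U :=
  le_ciSup (pdevZ_bddAbove hU) (x, i, j)

/-- [cite: Balaban1987RG1, p.254] the explicit constant `C₀ = C₀(d) = 500·(8(d+1)(d+4))²` of [B7] Prop. 1 (51) for the
(0.12)/(0.11) average certified in `B12Average012Prop1.prop1_avgBar` ([B7] p. 26 «The constant C₀ depends on d»);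
`c₂′ = B7Prop2Explicit.c2'` is the same as for the tree average. -/
def C0A (d : ℕ) : ℝ := 500 * (8 * ((d : ℝ) + 1) * (d + 4)) ^ 2

omit [NormedRing 𝔸] [NormedAlgebra ℂ 𝔸] [NormOneClass 𝔸] [CompleteSpace 𝔸] in
/-- [cite: Balaban1985Averaging, Prop. 1 (51) p.26] «positive constants C₀, c′₂»: `C₀(d) > 0`. -/
theorem C0A_pos (d : ℕ) : 0 < C0A d := by
  unfold C0A; positivity

/-- [cite: Balaban1985Averaging, (51)–(53) p.26] **THE INDUCTION STEP OF (53) FOR THE (0.12)/(0.11) AVERAGE**: if a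
`U1`-valued configuration `W` on `ℤᵈ` has `sup_p ‖W(∂p) − 1‖ < P ≤ c₂′`, then `sup_{p′} ‖W̄(∂p′) − 1‖ < L²P + C₀(L²P)²`
for `W̄ = avgBar` — [B7] Prop. 1 for the (0.12)/(0.11) average (`B12Average012Prop1.prop1_avgBar`) at every coarse
plaquette (the degenerate `μ = ν` contribute `0`), then the supremum. -/
theorem step012_lt (hL : 0 < L) (W : ZdEdge d → 𝔸ˣ) (hW : ∀ b, W b ∈ U1 𝔸) {P : ℝ} (hPc : P ≤ c2' d L)
    (hWP : pdevZ W < P) :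
    pdevZ (avgBar L W) < (L : ℝ) ^ 2 * P + C0A d * ((L : ℝ) ^ 2 * P) ^ 2 := by
  have hLr : (1 : ℝ) ≤ L := by exact_mod_cast hL
  set α := pdevZ W with hαdef
  have hα0 : 0 ≤ α := pdevZ_nonneg W
  have hpos : (0 : ℝ) < 512 * ((d : ℝ) + 1) * (d + 4) * (L : ℝ) ^ 2 := by positivity
  have hsmall : 512 * (d + 1) * (d + 4) * (L : ℝ) ^ 2 * α ≤ 1 := by
    have h1 : α ≤ 1 / (512 * ((d : ℝ) + 1) * (d + 4) * (L : ℝ) ^ 2) := hWP.le.trans hPc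
    rw [le_div_iff₀ hpos] at h1
    linarith
  have h44 : ∀ (x : Fin d → ℤ) (i j : Fin d), i ≠ j → ‖((plaquetteHolonomyZd W x i j : 𝔸ˣ) : 𝔸) - 1‖ ≤ α :=
    fun x i j _ => le_pdevZ hW x i j
  have hB0 : 0 ≤ (L : ℝ) ^ 2 * α + 500 * (8 * (d + 1) * (d + 4) * (L : ℝ) ^ 2 * α) ^ 2 := by positivity
  have hle : pdevZ (avgBar L W) ≤ (L : ℝ) ^ 2 * α + 500 * (8 * (d + 1) * (d + 4) * (L : ℝ) ^ 2 * α) ^ 2 := by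
    refine Real.iSup_le (fun p => ?_) hB0
    obtain ⟨y, μ, ν⟩ := p
    dsimp only
    by_cases hμν : μ = ν
    · subst hμν
      have h1 : plaquetteHolonomyZd (avgBar L W) y μ μ = 1 := by
        simp only [plaquetteHolonomyZd, mul_inv_cancel_right, mul_inv_cancel]
      rw [h1, Units.val_one, sub_self, norm_zero]
      exact hB0
    · exact prop1_avgBar hL W hW hα0 hsmall h44 y hμν
  refine hle.trans_lt ?_
  have hL2 : (0 : ℝ) < (L : ℝ) ^ 2 := by positivity
  have h1 : (L : ℝ) ^ 2 * α < (L : ℝ) ^ 2 * P := by gcongr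
  have h2 : (8 * ((d : ℝ) + 1) * (d + 4) * (L : ℝ) ^ 2 * α) ^ 2
      ≤ (8 * ((d : ℝ) + 1) * (d + 4) * (L : ℝ) ^ 2 * P) ^ 2 := by
    gcongr
  have hC : C0A d * ((L : ℝ) ^ 2 * P) ^ 2 = 500 * (8 * ((d : ℝ) + 1) * (d + 4) * (L : ℝ) ^ 2 * P) ^ 2 := by
    unfold C0A; ring
  rw [hC]
  linarith

end Step

/-! ## § 4  [B7] (43), (53) and Proposition 2 (54) for the iterated (0.12)/(0.11) average of a unitary configuration -/

section IterDefs

variable {𝔸 : Type*} [NormedRing 𝔸] [NormedAlgebra ℂ 𝔸] [CompleteSpace 𝔸]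

/-- [cite: Balaban1985Averaging, (43) p.24] **the `k`-fold (0.12)/(0.11) average** `Ū^{k+1} = \\overline{(Ū^k)}`,
`Ū⁰ = U`, every coarse lattice identified with `ℤᵈ` (the b12 lineage indexes the coarse bonds of `avgBar` by coarse
coordinates, so no rescaling map is needed: `B7Prop2Explicit.avgIter` for [I]'s average). -/
def avgIter012 (L : ℕ) (U : ZdEdge d → 𝔸ˣ) : ℕ → ZdEdge d → 𝔸ˣ
  | 0 => U
  | j + 1 => avgBar L (avgIter012 L U j)

/-- [cite: Balaban1985Averaging, (43) p.24] `Ū⁰ = U`. -/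
@[simp] theorem avgIter012_zero (L : ℕ) (U : ZdEdge d → 𝔸ˣ) : avgIter012 L U 0 = U := rfl

/-- [cite: Balaban1985Averaging, (43) p.24] `Ū^{j+1} = \\overline{(Ū^j)}`. -/
theorem avgIter012_succ (L : ℕ) (U : ZdEdge d → 𝔸ˣ) (j : ℕ) :
    avgIter012 L U (j + 1) = avgBar L (avgIter012 L U j) := rfl

end IterDefs

section Iteration

variable {𝔸 : Type*} [CStarAlgebra 𝔸] [Nontrivial 𝔸] {L : ℕ}

/-- [cite: Balaban1985Averaging, (52)–(53) p.26] **ALL LEVELS `Ū^j`, `j ≤ k`, STAY UNITARY** (tacit in print): under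
(52) `sup_p ‖U(∂p) − 1‖ < α₀η²`, `η = L^{−k}`, and `C₀α₀ ≤ 1/3`, `2α₀ ≤ c₂′`, by induction on `j` with (53) at level `j`
(`B7.ineq53_induction`) the configuration `Ū^j` is `ε`-regular with `ε < 2α₀ ≤ c₂′`, hence `(dL)²ε ≤ 1/512`, and the
closure `avgBar_mem_unitaryUnits` applies (`d ≥ 1`, `L ≥ 2`). -/
theorem avgIter012_mem (hL : 2 ≤ L) (hd : 1 ≤ d) (k : ℕ) (U : ZdEdge d → 𝔸ˣ) (hU : ∀ b, U b ∈ unitaryUnits 𝔸)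
    {α₀ : ℝ} (hα : 0 < α₀) (hα3 : C0A d * α₀ ≤ 1 / 3) (hα2 : 2 * α₀ ≤ c2' d L)
    (h52 : pdevZ U < α₀ * (((L : ℝ) ^ k)⁻¹) ^ 2) :
    ∀ j ≤ k, ∀ b, avgIter012 L U j b ∈ unitaryUnits 𝔸 := by
  have hL1 : 1 ≤ L := le_trans (by norm_num) hL
  have hL0 : 0 < L := hL1
  have hLr : (2 : ℝ) ≤ L := by exact_mod_cast hL
  have hL1r : (1 : ℝ) ≤ L := by linarith
  have hdr : (1 : ℝ) ≤ d := by exact_mod_cast hd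
  have hC := C0A_pos d
  set η : ℝ := ((L : ℝ) ^ k)⁻¹ with hη
  have hη0 : 0 < η := by positivity
  set a : ℕ → ℝ := fun j => pdevZ (avgIter012 L U j) with hadef
  have h52' : a 0 < α₀ * η ^ 2 := h52
  have hr0 : 0 ≤ (1 + C0A d * α₀) ^ 2 / (L : ℝ) ^ 2 := by positivity
  have hrhalf : (1 + C0A d * α₀) ^ 2 / (L : ℝ) ^ 2 ≤ 1 / 2 :=
    (B7.prop2_ratio_lt_half (C0A d) α₀ L hLr (mul_nonneg hC.le hα.le) hα3).le
  -- `2α₀ ≤ c₂′` forces `(dL)²·2α₀ ≤ 1/512`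
  have hsm2 : ((d : ℝ) * L) ^ 2 * (2 * α₀) ≤ 1 / 512 := by
    have hpos : (0 : ℝ) < 512 * ((d : ℝ) + 1) * (d + 4) * (L : ℝ) ^ 2 := by positivity
    have h1 : 2 * α₀ ≤ 1 / (512 * ((d : ℝ) + 1) * (d + 4) * (L : ℝ) ^ 2) := hα2
    rw [le_div_iff₀ hpos] at h1
    have h2 : ((d : ℝ) * L) ^ 2 ≤ (d + 1) * (d + 4) * (L : ℝ) ^ 2 := by
      have : (d : ℝ) ^ 2 ≤ (d + 1) * (d + 4) := by nlinarith
      have hL2 : (0 : ℝ) ≤ (L : ℝ) ^ 2 := by positivity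
      nlinarith
    have h3 : 0 ≤ 2 * α₀ := by linarith
    nlinarith [mul_le_mul_of_nonneg_right h2 h3]
  -- induction on the level, carrying the unitarity of ALL lower levels
  suffices H : ∀ j, j ≤ k → ∀ i ≤ j, ∀ b, avgIter012 L U i b ∈ unitaryUnits 𝔸 from
    fun j hj => H j hj j le_rfl
  intro j
  induction j with
  | zero =>
      intro _ i hi
      obtain rfl : i = 0 := Nat.le_zero.mp hi
      simpa using hU
  | succ j ih =>
      intro hjk i hi
      have hjk' : j ≤ k := Nat.le_of_succ_le hjk
      have ihj := ih hjk'
      rcases Nat.lt_or_eq_of_le hi with hlt | rfl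
      · exact ihj i (Nat.lt_succ_iff.mp hlt)
      -- the new level `j + 1`: first (53) at level `j`
      have hstep : ∀ i < j, ∀ P : ℝ, 0 < P → P ≤ c2' d L → a i < P →
          a (i + 1) < (L : ℝ) ^ 2 * P + C0A d * ((L : ℝ) ^ 2 * P) ^ 2 :=
        fun i hi P _ hPc hiP => step012_lt hL0 _ (fun b => unitaryUnits_le_U1 (ihj i hi.le b)) hPc hiP
      have hηj : (L : ℝ) ^ j * η ≤ 1 := by
        rw [hη, ← div_eq_mul_inv, div_le_one (by positivity)]
        exact pow_le_pow_right₀ hL1r hjk'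
      have h53 := B7.ineq53_induction (L : ℝ) η α₀ (C0A d) (c2' d L) j a hLr hη0 hηj (C0A_pos d) hα hα3 hα2
        h52' hstep j le_rfl
      have hS0 : 0 ≤ ∑ i ∈ Finset.range j, ((1 + C0A d * α₀) ^ 2 / (L : ℝ) ^ 2) ^ i :=
        Finset.sum_nonneg fun i _ => pow_nonneg hr0 i
      have hS2 := B7.geom_bracket_le_two _ hr0 hrhalf j
      have hbound : a j < α₀ + 2 * C0A d * α₀ ^ 2 :=
        h53.trans_le (B7Prop2Explicit.bound53_le (C0A_pos d).le hα.le (by positivity) hηj hS0 hS2)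
      have htwo := B7.prop2_bound_lt_two_alpha (C0A d) α₀ hα hα3
      -- so `Ū^j` is `ε`-regular with `ε := a j < 2α₀`, `(dL)²ε ≤ 1/512 ≤ 1/100`
      have hUj : ∀ b, avgIter012 L U j b ∈ unitaryUnits 𝔸 := ihj j le_rfl
      have hU1 : ∀ b, avgIter012 L U j b ∈ U1 𝔸 := fun b => unitaryUnits_le_U1 (hUj b)
      have hαj0 : 0 ≤ a j := pdevZ_nonneg _
      have hsm : ((d : ℝ) * L) ^ 2 * a j ≤ 1 / 100 := by
        have hdl : 0 ≤ ((d : ℝ) * L) ^ 2 := by positivity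
        have := mul_le_mul_of_nonneg_left (hbound.trans htwo).le hdl
        linarith
      have h44 : ∀ (x : Fin d → ℤ) (i i' : Fin d), i ≠ i' →
          ‖((plaquetteHolonomyZd (avgIter012 L U j) x i i' : 𝔸ˣ) : 𝔸) - 1‖ ≤ a j :=
        fun x i i' _ => le_pdevZ hU1 x i i'
      intro b
      rw [avgIter012_succ]
      exact avgBar_mem_unitaryUnits hL0 hd _ hUj hαj0 hsm h44 b

/-- [cite: Balaban1985Averaging, (53) p.26] **(53) FOR THE ITERATED (0.12)/(0.11) AVERAGE**: under (52) and
`C₀α₀ ≤ 1/3`, `2α₀ ≤ c₂′`, for all `j ≤ k`: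
`sup_p ‖Ū^j(∂p) − 1‖ < α₀(L^jη)² + C₀(α₀(L^jη)²)²·[1 + L⁻²(1+C₀α₀)² + … + (L⁻²(1+C₀α₀)²)^{j−1}]`. -/
theorem ineq53_012 (hL : 2 ≤ L) (hd : 1 ≤ d) (k : ℕ) (U : ZdEdge d → 𝔸ˣ) (hU : ∀ b, U b ∈ unitaryUnits 𝔸)
    {α₀ : ℝ} (hα : 0 < α₀) (hα3 : C0A d * α₀ ≤ 1 / 3) (hα2 : 2 * α₀ ≤ c2' d L)
    (h52 : pdevZ U < α₀ * (((L : ℝ) ^ k)⁻¹) ^ 2) :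
    ∀ j ≤ k, pdevZ (avgIter012 L U j) < α₀ * ((L : ℝ) ^ j * ((L : ℝ) ^ k)⁻¹) ^ 2 +
      C0A d * (α₀ * ((L : ℝ) ^ j * ((L : ℝ) ^ k)⁻¹) ^ 2) ^ 2 *
        ∑ i ∈ Finset.range j, ((1 + C0A d * α₀) ^ 2 / (L : ℝ) ^ 2) ^ i := by
  have hL1 : 1 ≤ L := le_trans (by norm_num) hL
  have hLr : (2 : ℝ) ≤ L := by exact_mod_cast hL
  have hL1r : (1 : ℝ) ≤ L := by linarith
  have hmem := avgIter012_mem hL hd k U hU hα hα3 hα2 h52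
  have hηk : (L : ℝ) ^ k * ((L : ℝ) ^ k)⁻¹ ≤ 1 := by
    rw [mul_inv_cancel₀ (by positivity)]
  exact B7.ineq53_induction (L : ℝ) _ α₀ (C0A d) (c2' d L) k (fun j => pdevZ (avgIter012 L U j)) hLr
    (by positivity) hηk (C0A_pos d) hα hα3 hα2 h52
    (fun j hj P _ hPc hjP => step012_lt hL1 _ (fun b => unitaryUnits_le_U1 (hmem j hj.le b)) hPc hjP)

/-- [cite: Balaban1987RG1, p.254] **[B7] PROPOSITION 2 (54) FOR THE ITERATED (0.12)/(0.11) AVERAGE OF [I]** («all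
results of the paper [12] are valid for it»; [B7] p. 26 «If U satisfies (52) with α₀ ≤ c₂ = min{1/(3C₀), ½c′₂}, then
|Ū^k(∂p) − 1| < α₀ + 2C₀α₀² < 2α₀, p ⊂ Ω^{(k)}»): for a unitary configuration `U` on `ℤᵈ` (`d ≥ 1`, `L ≥ 2`; any
non-trivial C⋆-algebra, `M_N(ℂ)` with `G = U(N)` included) with `sup_p ‖U(∂p) − 1‖ < α₀η²`, `η = L^{−k}`,
`C₀α₀ ≤ 1/3`, `2α₀ ≤ c₂′` (`C₀ = 500·64(d+1)²(d+4)²`, `c₂′ = 1/(512(d+1)(d+4)L²)`):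
`sup_p ‖Ū^k(∂p) − 1‖ < α₀ + 2C₀α₀²`, and every `Ū^j`, `j ≤ k`, is unitary. -/
theorem prop2_012 (hL : 2 ≤ L) (hd : 1 ≤ d) (k : ℕ) (U : ZdEdge d → 𝔸ˣ) (hU : ∀ b, U b ∈ unitaryUnits 𝔸)
    {α₀ : ℝ} (hα : 0 < α₀) (hα3 : C0A d * α₀ ≤ 1 / 3) (hα2 : 2 * α₀ ≤ c2' d L)
    (h52 : pdevZ U < α₀ * (((L : ℝ) ^ k)⁻¹) ^ 2) :
    pdevZ (avgIter012 L U k) < α₀ + 2 * C0A d * α₀ ^ 2 ∧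
      ∀ j ≤ k, ∀ b, avgIter012 L U j b ∈ unitaryUnits 𝔸 := by
  have hL1 : 1 ≤ L := le_trans (by norm_num) hL
  have hLr : (2 : ℝ) ≤ L := by exact_mod_cast hL
  have hmem := avgIter012_mem hL hd k U hU hα hα3 hα2 h52
  refine ⟨?_, hmem⟩
  have hηk : (L : ℝ) ^ k * ((L : ℝ) ^ k)⁻¹ = 1 := mul_inv_cancel₀ (by positivity)
  exact B7.prop2_of_ineq53 (L : ℝ) _ α₀ (C0A d) (c2' d L) k (fun j => pdevZ (avgIter012 L U j)) hLr
    (by positivity) hηk (C0A_pos d) hα hα3 hα2 h52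
    (fun j hj P _ hPc hjP => step012_lt hL1 _ (fun b => unitaryUnits_le_U1 (hmem j hj.le b)) hPc hjP)

/-- [cite: Balaban1985Averaging, Prop. 2 (54) p.26] the last inequality of (54) for the (0.12)/(0.11) average: the
bound is `< 2α₀` («uniformly in k»; the form used in [I] p. 265 «⇒ |W(∂p′) − 1| < 2ε₀, Prop 2 [12]»). -/
theorem prop2_012_lt_two (hL : 2 ≤ L) (hd : 1 ≤ d) (k : ℕ) (U : ZdEdge d → 𝔸ˣ)
    (hU : ∀ b, U b ∈ unitaryUnits 𝔸) {α₀ : ℝ} (hα : 0 < α₀) (hα3 : C0A d * α₀ ≤ 1 / 3)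
    (hα2 : 2 * α₀ ≤ c2' d L) (h52 : pdevZ U < α₀ * (((L : ℝ) ^ k)⁻¹) ^ 2) :
    pdevZ (avgIter012 L U k) < 2 * α₀ :=
  (prop2_012 hL hd k U hU hα hα3 hα2 h52).1.trans (B7.prop2_bound_lt_two_alpha (C0A d) α₀ hα hα3)

end Iteration

/-! ## § 5  The quoted leaf `B7.Prop2Printed`, instantiated and proved for the (0.12)/(0.11) average -/

section ConcreteDef

variable {𝔸 : Type} [NormedRing 𝔸] [NormedAlgebra ℂ 𝔸] [CompleteSpace 𝔸] [StarMul 𝔸]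

variable (d 𝔸) in
/-- [cite: Balaban1987RG1, (0.12) p.254] the concrete `k`-fold family of [B7] Sect. B (`B7.KStep`) for [I]'s average
(0.12) over the averaged contour variables (0.11) on `ηℤᵈ` read on the unit lattice: index `k`; `Cfg` = unitary
configurations; `plaqDevEta U = sup_p ‖U(∂p) − 1‖·η⁻²` (hypothesis (52)); `avgDevK U = sup_p ‖Ū^k(∂p) − 1‖`
(conclusion (54)) — exactly as `B7Prop2Explicit.concreteKStep` for the average (42). -/
def concreteKStep012 (L k : ℕ) : B7.KStep where
  Cfg := {U : ZdEdge d → 𝔸ˣ // ∀ b, U b ∈ unitaryUnits 𝔸}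
  k := k
  plaqDevEta U := pdevZ U.1 * ((L : ℝ) ^ k) ^ 2
  avgDevK U := pdevZ (avgIter012 L U.1 k)

end ConcreteDef

section Concrete

variable {𝔸 : Type} [CStarAlgebra 𝔸] [Nontrivial 𝔸]

/-- [cite: Balaban1987RG1, p.254] **[B7] PROPOSITION 2 AS PRINTED (`B7.Prop2Printed`) PROVED FOR THE `k`-FOLD
(0.12)/(0.11) AVERAGE OF [I]** on `ℤᵈ` (`d ≥ 1`, `L ≥ 2`), unitary configurations in any non-trivial C⋆-algebra, with
`C₀ = 500·64(d+1)²(d+4)²`, `c₂′ = 1/(512(d+1)(d+4)L²)` and `c₂ = min{1/(3C₀), ½c₂′}` exactly as printed, uniformly in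
`k` — p. 254 «all results of the paper [12] are valid for it», for [12]'s Proposition 2. -/
theorem prop2Printed_avgBar (L : ℕ) (hL : 2 ≤ L) (hd : 1 ≤ d) :
    B7.Prop2Printed (C0A d) (c2' d L) (fun k : ℕ => concreteKStep012 d 𝔸 L k) := by
  intro k α₀ hα₀ hαmin U h52
  obtain ⟨U, hU⟩ := U
  simp only [concreteKStep012] at h52 ⊢
  have hC := C0A_pos d
  have hα3 : C0A d * α₀ ≤ 1 / 3 := by
    have h := hαmin.trans (min_le_left _ _)
    rw [le_div_iff₀ (by positivity : (0 : ℝ) < 3 * C0A d)] at h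
    linarith
  have hα2 : 2 * α₀ ≤ c2' d L := by
    have h := hαmin.trans (min_le_right _ _)
    linarith
  have hLk : (0 : ℝ) < ((L : ℝ) ^ k) ^ 2 := by
    have : (1 : ℝ) ≤ L := by exact_mod_cast le_trans (by norm_num) hL
    positivity
  have h52' : pdevZ U < α₀ * (((L : ℝ) ^ k)⁻¹) ^ 2 := by
    rw [inv_pow, ← div_eq_mul_inv, lt_div_iff₀ hLk]
    exact h52
  exact (prop2_012 hL hd k U hU hα₀ hα3 hα2 h52').1

end Concrete

/-! ## § 6  The paper's own setting: `G = U(N) ⊂ M_N(ℂ)` with the operator norm -/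

section Matrices

open scoped Matrix.Norms.L2Operator

/-- [cite: Balaban1987RG1, p.254] **[B7] PROPOSITION 2 FOR THE `k`-FOLD (0.12)/(0.11) AVERAGE, `G = U(N)`, `N ≥ 1`**:
configurations on `ℤᵈ` with values in `U(N) ⊂ M_N(ℂ)` (the `L²`-operator norm, scope `Matrix.Norms.L2Operator`),
`C₀ = 500·64(d+1)²(d+4)²`, `c₂′ = 1/(512(d+1)(d+4)L²)`, `L ≥ 2`, `d ≥ 1`, uniformly in `k`. -/
theorem prop2Printed_avgBar_unitaryGroup (N : ℕ) [NeZero N] (L : ℕ) (hL : 2 ≤ L) (hd : 1 ≤ d) :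
    B7.Prop2Printed (C0A d) (c2' d L)
      (fun k : ℕ => concreteKStep012 d (Matrix (Fin N) (Fin N) ℂ) L k) := by
  letI : CStarAlgebra (Matrix (Fin N) (Fin N) ℂ) := {}
  exact prop2Printed_avgBar L hL hd

end Matrices

/-! ## § 7  [I] p. 260 / p. 265 «By Proposition 2 [12] … |W(∂p′) − 1| < 2ε₀» for the ACTUAL (0.12)/(0.11) average -/

section Claims

variable {𝔸 : Type*} [CStarAlgebra 𝔸] [Nontrivial 𝔸]

omit [Nontrivial 𝔸] in
/-- [cite: Balaban1987RG1, (1.2) p.260] ONE displayed smallness `L²ε₀ ≤ 1/(3C₀)` («with ε₀ sufficiently small»)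
implies the two working hypotheses `C₀ε₀ ≤ 1/3`, `2ε₀ ≤ c₂′` of [B7] Prop. 2 for the (0.12)/(0.11) average
(`C₀ = C0A d`, `c₂′ = 1/(512(d+1)(d+4)L²)`; `L ≥ 1`). -/
theorem smallness012_of_L2 {L : ℕ} (hL : 1 ≤ L) {ε₀ : ℝ} (hε : 0 ≤ ε₀)
    (h : (L : ℝ) ^ 2 * ε₀ ≤ 1 / (3 * C0A d)) : C0A d * ε₀ ≤ 1 / 3 ∧ 2 * ε₀ ≤ c2' d L := by
  have hC := C0A_pos d
  have hLr : (1 : ℝ) ≤ L := by exact_mod_cast hL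
  have hL2 : (1 : ℝ) ≤ (L : ℝ) ^ 2 := one_le_pow₀ hLr
  have h1 : (L : ℝ) ^ 2 * ε₀ * (3 * C0A d) ≤ 1 := by
    rwa [le_div_iff₀ (by positivity)] at h
  refine ⟨?_, ?_⟩
  · have : ε₀ ≤ (L : ℝ) ^ 2 * ε₀ := by nlinarith
    nlinarith
  · rw [c2', le_div_iff₀ (by positivity)]
    have hC' : C0A d = 500 * (8 * ((d : ℝ) + 1) * (d + 4)) ^ 2 := rfl
    have hd4 : (1 : ℝ) ≤ ((d : ℝ) + 1) * (d + 4) := by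
      have : (0 : ℝ) ≤ d := by positivity
      nlinarith
    rw [hC'] at h1
    nlinarith [mul_nonneg (mul_nonneg (by positivity : (0 : ℝ) ≤ (L : ℝ) ^ 2) hε)
      (by positivity : (0 : ℝ) ≤ ((d : ℝ) + 1) * (d + 4))]

/-- [cite: Balaban1987RG1, (1.2) p.260] **p. 260 «By Proposition 2 [12] this condition implies that |V(∂p′) − 1| <
2ε₀ for p′ ∈ T_1^{(k)}» FOR THE ACTUAL AVERAGE `V = M^k(U)` OF [I]** ((1.1) with the (0.12)/(0.11) averaging):
there is `c = 1/(3C₀(d)) > 0` such that for every `L ≥ 2`, `k`, `ε₀ > 0` with `L²ε₀ ≤ c` and every unitary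
configuration `U` on `T_η ≅ ℤᵈ` with `sup_p ‖U(∂p) − 1‖ < ε₀η²`, `η = L^{−k}` (the first condition of (1.2)):
`sup_{p′} ‖Ū^k(∂p′) − 1‖ < 2ε₀` (companion of `B12Prop2Claims260.Claim260Printed_holds`, which is the same sentence
for the tree-contour model average `B7Prop2Explicit.avgIter`). -/
theorem claim260_012 (hd : 1 ≤ d) :
    ∃ c : ℝ, 0 < c ∧ ∀ L : ℕ, 2 ≤ L → ∀ k : ℕ, ∀ ε₀ : ℝ, 0 < ε₀ → (L : ℝ) ^ 2 * ε₀ ≤ c →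
      ∀ U : ZdEdge d → 𝔸ˣ, (∀ b, U b ∈ unitaryUnits 𝔸) →
        pdevZ U < ε₀ * (((L : ℝ) ^ k)⁻¹) ^ 2 → pdevZ (avgIter012 L U k) < 2 * ε₀ := by
  refine ⟨1 / (3 * C0A d), by have := C0A_pos d; positivity, ?_⟩
  intro L hL k ε₀ hε hsmall U hU h12
  obtain ⟨hC, hc2'⟩ := smallness012_of_L2 (d := d) (le_trans (by norm_num) hL) hε.le hsmall
  exact prop2_012_lt_two hL hd k U hU hε hC hc2' h12

/-- [cite: Balaban1987RG1, p.265] **p. 265 «More exactly we assume that W is so regular that the minimal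
configurations U_{k+1}(W) exist and belong to the space U_{k+1}(ε₀). By Proposition 2 from the paper [12] this
implies that |W(∂p′) − 1| < 2ε₀ for p′ ∈ T^{(k+1)}» FOR THE ACTUAL AVERAGE `W = M^{k+1}(U_{k+1}(W))` OF [I]** — the
p. 260 sentence at level `k + 1` (companion of `B12Prop2Claims260.Claim265Printed_holds`). -/
theorem claim265_012 (hd : 1 ≤ d) :
    ∃ c : ℝ, 0 < c ∧ ∀ L : ℕ, 2 ≤ L → ∀ k : ℕ, ∀ ε₀ : ℝ, 0 < ε₀ → (L : ℝ) ^ 2 * ε₀ ≤ c →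
      ∀ U : ZdEdge d → 𝔸ˣ, (∀ b, U b ∈ unitaryUnits 𝔸) →
        pdevZ U < ε₀ * (((L : ℝ) ^ (k + 1))⁻¹) ^ 2 → pdevZ (avgIter012 L U (k + 1)) < 2 * ε₀ := by
  obtain ⟨c, hc, h⟩ := claim260_012 (𝔸 := 𝔸) hd
  exact ⟨c, hc, fun L hL k => h L hL (k + 1)⟩

end Claims

end Literature.MathematicalPhysics.QuantumFieldTheory.Balaban1983to89.B12Average012Prop2

end
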